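import Summits.QuantumFields.YangMills.Theses.BalabanLadder
import Literature.MathematicalPhysics.QuantumFieldTheory.LatticeGaugeProofs
import HarnessLib

/-!
# Crux `IR` (stmt-QuantumFields-19354) — VOCABULARY of the withdrawn line `defect-chain-price` (ideator ym-ir-idea-3)
# as tree constants: torus defect chains, bad boxes of the time-axis tube, the three stub statements S1–S3

Helper module for item `stmt-QuantumFields-19354` (`--supports … --as helper`; it closes nothing and asserts nothing).
The ideator workfile `Cruxes/IR/Lines/defect_chain_price.lean` (commit 04ee1464a315; line STRUCK as typed — its load S2 is
crux-equivalent — and withdrawn with the recommendation «no mechanism; bank the engine (S1 `ChainRarity`, S3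
`DominationEngine`)», idea-3 → director, 2026-08-27T23:59:58Z) carries its vocabulary (§1) and stub statements (§2) in-file,
because crux workfiles are not importable modules.  The engine S3 is a tree theorem already (`Theorems/IR/
DefectChainDominationEngine.lean`, p636154, statement unfolded — it is definition-free).  The support stub S1 `ChainRarity`
(«hereditary chessboard–Peierls rarity of bad boxes at the correlation scale», M∕L) speaks about the line's own objects
(`tubeBox`, `HasDefectChain`, `badBox`, `scaleL`, `chainK`), so this file makes §1 and §2 tree constants VERBATIM (namespace
`…Cruxes.IR.DefectChain`, distinct from the workfile's `…DefectChainPrice` so that a re-based workfile can import both this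
file and the engine), and the companion `Theorems/IR/DefectChainRarity.lean` PROVES `chainRarity_holds : ChainRarity`.

NOTHING here is asserted: `ChainRarity` / `PricedClustering` / `DominationEngine` are `def … : Prop` LINE STATEMENTS (S2 is the
line's crux-equivalent load; S1, S3 are its supports), not literature facts and not claims.

HONEST FRAMING.  Bookkeeping only.  Nothing in this file bears on `BalabanLadder.IR` (0/1), confinement, a lattice gap or the
Yang–Mills mass gap (Clay), which are NOT proved; `R4` closes only the conditional finite-𝕋⁴ rung `BalabanLadder.UV`.
Card: `Cruxes/IR/Lines/defect-chain-price.md` (dead: `Lines/defect-chain-price-dead.md`).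
-/

set_option autoImplicit false

noncomputable section

open MeasureTheory Filter Topology
open Literature.MathematicalPhysics.QuantumFieldTheory Literature.MathematicalPhysics.QuantumLattice
open Summit.QuantumFields.YangMills.Cruxes.OSLegsFromFemtoAndGap.DlrCollarTransfer (GapInUnits LowerBounds)

namespace Summit.QuantumFields.YangMills.Cruxes.IR.DefectChain

/-! ## §1 Torus geometry, defects, defect chains, bad boxes (VERBATIM §1 of the workfile) -/

/-- Distance from `0` on the cycle `ℤ/Lℤ`. -/
def znorm {L : ℕ} (z : ZMod L) : ℕ := min z.val (L - z.val)

/-- Sup-distance of two sites of the torus `(ℤ/Lℤ)⁴`. -/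
def siteDist {L : ℕ} (x y : Site 4 L) : ℕ := Finset.univ.sup fun i : Fin 4 => znorm (x i - y i)

/-- The `j`-th coarse box of side `ℓ` of the time-axis tube based at the origin: time coordinate in
`[jℓ, (j+1)ℓ)`, spatial coordinates at cycle-distance `< ℓ` from `0`. -/
def tubeBox (L ℓ j : ℕ) : Set (Site 4 L) :=
  {x | (∃ τ : ℕ, j * ℓ ≤ τ ∧ τ < (j + 1) * ℓ ∧ x 0 = (τ : ZMod L)) ∧ ∀ i : Fin 4, i ≠ 0 → znorm (x i) < ℓ}

variable {G : Type} [Group G] {N : ℕ}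

/-- A DEFECT CHAIN of `k+1` distinct plaquettes of `U` starting in `B`: consecutive base sites at sup-distance `≤ 2`,
every plaquette of Wilson cost `N − Re tr ρ(U_q) ≥ 1`. -/
def HasDefectChain {L : ℕ} (ρ : G →* Matrix (Fin N) (Fin N) ℂ) (U : GaugeConfig 4 L G) (k : ℕ)
    (B : Set (Site 4 L)) : Prop :=
  ∃ c : Fin (k + 1) → Plaquette 4 L, Function.Injective c ∧ (c 0).1 ∈ B ∧
    (∀ i : Fin k, siteDist (c i.castSucc).1 (c i.succ).1 ≤ 2) ∧ ∀ i, (1 : ℝ) ≤ plaquetteCost ρ U (c i)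

/-- BAD BOX `j` (chain threshold `k`, side `ℓ`): a defect chain of `k+1` plaquettes starts in the `j`-th tube box. -/
def badBox {L : ℕ} (ρ : G →* Matrix (Fin N) (Fin N) ℂ) (k ℓ j : ℕ) : Set (GaugeConfig 4 L G) :=
  {U | HasDefectChain ρ U k (tubeBox L ℓ j)}

open Classical in
/-- Number of bad boxes among the first `m` boxes of the tube. -/
def badCount {L : ℕ} (ρ : G →* Matrix (Fin N) (Fin N) ℂ) (k ℓ m : ℕ) (U : GaugeConfig 4 L G) : ℕ :=
  ((Finset.range m).filter fun j => U ∈ badBox ρ k ℓ j).card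

/-- The coarse scale `ℓ(β) = ⌈θ / a(β)⌉` (≍ `θ` correlation lengths in lattice units). -/
def scaleL (a : ℝ → ℝ) (θ β : ℝ) : ℕ := ⌈θ / a β⌉₊

/-- The chain threshold `k(β) = ⌈log (1 / a(β))⌉` (≍ `log ξ`: chains shorter than this are left to the bulk). -/
def chainK (a : ℝ → ℝ) (β : ℝ) : ℕ := ⌈Real.log (1 / a β)⌉₊

/-! ## §2 The stub statements as named `Prop`s (VERBATIM §2 of the workfile) -/

/-- **S1 (support, M∕L — chessboard Peierls at the correlation scale).**  Bad boxes of the tube are HEREDITARILY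
`p(β)`-DOMINATED under the torus Wilson measure, `p(β) → 0`, uniformly in the volume: for every family `F` of box
indices, `μ(all boxes of F bad) ≤ p(β)^{#F}`.  LINE STATEMENT (support stub of the withdrawn line `defect-chain-price`);
PROVED in `Theorems/IR/DefectChainRarity.lean` (`chainRarity_holds`). -/
def ChainRarity : Prop :=
  ∀ (G : Type) [Group G] [TopologicalSpace G] [IsTopologicalGroup G] [CompactSpace G],
    IsCompactSimpleLieGroup G →
    letI : MeasurableSpace G := borel G; haveI : BorelSpace G := ⟨rfl⟩;
    ∀ (r : LatticeRep G) (a : ℝ → ℝ), (∀ β, 0 < a β) → Tendsto a atTop (𝓝 0) →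
    ∀ θ : ℝ, 0 < θ →
      ∃ p : ℝ → ℝ, Tendsto p atTop (𝓝 0) ∧ (∀ β, 0 ≤ p β) ∧
        ∀ (β : ℝ) (S m : ℕ), m * scaleL a θ β ≤ S →
          ∀ F ⊆ Finset.range m,
            (wilsonMeasure (d := 4) (L := 2 * S + 1) r.ρ β).real
                {U | ∀ j ∈ F, U ∈ badBox r.ρ (chainK a β) (scaleL a θ β) j} ≤ p β ^ F.card

/-- **S2 (crux of the line, XL — the asymptotic-freedom ∕ confinement physics in ANNEALED-PRICED format).**  Under
`LowerBounds`, connected torus correlations decay at rate `c₁ a(β)` UP TO AN ANNEALED PRICE `t^{#bad boxes}` on the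
time-axis tube of coarse boxes of side `⌈θ/a(β)⌉`.  With `t = 1` this IS `GapInUnits` (STRUCK by ym-ir-crit-1∕2 as
crux-equivalent; the line was withdrawn).  LINE STATEMENT, OPEN; recorded only so that a re-based workfile reads all three
stubs off this module. -/
def PricedClustering : Prop :=
  ∀ (G : Type) [Group G] [TopologicalSpace G] [IsTopologicalGroup G] [CompactSpace G],
    IsCompactSimpleLieGroup G →
    letI : MeasurableSpace G := borel G; haveI : BorelSpace G := ⟨rfl⟩;
    ∀ (r : LatticeRep G) (a : ℝ → ℝ), (∀ β, 0 < a β) → Tendsto a atTop (𝓝 0) → LowerBounds G r a →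
      ∃ (θ t c₁ β₂ : ℝ) (S₁ : ℝ → ℕ), 0 < θ ∧ 1 ≤ t ∧ 0 < c₁ ∧
        ∀ A B : YMSpecies G, ∃ C : ℝ, 0 ≤ C ∧ ∀ β : ℝ, β₂ ≤ β → ∀ S n : ℕ, S₁ β ≤ S → n ≤ S →
          |latticeConnectedCorr r.ρ β (2 * S + 1) A.F B.F n| ≤
            C * (∫ U, t ^ badCount r.ρ (chainK a β) (scaleL a θ β) (n / scaleL a θ β) U
                  ∂(wilsonMeasure (d := 4) (L := 2 * S + 1) r.ρ β)) * Real.exp (-(c₁ * a β * n))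

open Classical in
/-- **S3 (support, M — the disagreement-percolation ∕ domination engine, pure probability).**  If the indicators of
`bad 0, …, bad (m−1)` are hereditarily `p`-dominated (`μ(⋂_{j∈F} bad j) ≤ p^{#F}` for all `F`), then
`E_μ[t^{#{j<m : bad j}}] ≤ e^{(t−1) p m}` for `t ≥ 1`.  LINE STATEMENT; PROVED (statement unfolded) as
`DefectChainPrice.dominationEngine_holds` (`Theorems/IR/DefectChainDominationEngine.lean`, p636154). -/
def DominationEngine : Prop :=
  ∀ (Ω : Type) [MeasurableSpace Ω] (μ : Measure Ω) [IsProbabilityMeasure μ] (bad : ℕ → Set Ω) (m : ℕ) (p t : ℝ),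
    0 ≤ p → 1 ≤ t →
    (∀ F ⊆ Finset.range m, μ.real {ω | ∀ j ∈ F, ω ∈ bad j} ≤ p ^ F.card) →
    (∫ ω, t ^ ((Finset.range m).filter fun j => ω ∈ bad j).card ∂μ) ≤ Real.exp ((t - 1) * p * m)

end Summit.QuantumFields.YangMills.Cruxes.IR.DefectChain

end
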